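import Literature.NumberTheory.GaloisRepresentations.GlobalReciprocityExistenceProofs
import Literature.NumberTheory.GaloisRepresentations.ContinuousCharactersExtend
import Literature.GroupTheory.ProfiniteSubquotients
import Literature.NumberTheory.GaloisRepresentations.AbsGaloisGroupCompact
import HarnessLib

/-!
# The reciprocity map modulo `m`-th powers: `C_K / C_Kᵐ ≅ Γ_K^{ab} / (Γ_K^{ab})ᵐ`, and the
# `m`-th power classes of `C_K` are detected by continuous characters of `Γ_K^{ab}` killed by `m`

Topic `NumberTheory/GaloisRepresentations` (global class field theory); namespace
`Literature.NumberTheory.GaloisRepresentations.IsGlobalReciprocityMap`.  Theorems only (no definition,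
no named fact, no instance).

Let `K` be a number field, `C_K = 𝕀_K / Kˣ` its idèle class group and `θ : C_K → Γ_K^{ab}` a map with
the printed properties of the universal norm residue symbol (`IsGlobalReciprocityMap K θ`: continuous,
surjective, `ker θ = D_K =` the infinitely divisible classes, existence theorem) — for `K : Type` such a
`θ` EXISTS by the tree's theorem `exists_isGlobalReciprocityMap_holds`.  For `m ≥ 1`:

* `exists_pow_eq_of_map_eq_one` — `ker θ ≤ C_Kᵐ` (an infinitely divisible class is an `m`-th power);
* **`map_mem_range_powMonoidHom_iff`** — `θ a ∈ (Γ_K^{ab})ᵐ ↔ a ∈ C_Kᵐ`; `comap_range_powMonoidHom`;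
* **`map_div_mem_range_powMonoidHom_iff`**, `exists_map_div_mem_range_powMonoidHom` — coset form of
  «the homomorphism `C_K / C_Kᵐ → Γ_K^{ab} / (Γ_K^{ab})ᵐ` induced by `θ` is BIJECTIVE» (Neukirch III (7.12)
  read modulo `m`: surjectivity of `θ`, and `θ⁻¹((Γ^{ab})ᵐ) = C_Kᵐ · D_K = C_Kᵐ`);
* `isClosed_range_powMonoidHom_abelianization` — `(Γ_K^{ab})ᵐ` is closed (continuous image of a
  compact group in a Hausdorff group);
* **`exists_character_apply_ne_zero_of_not_mem_range_pow`** — if `a ∉ C_Kᵐ` there is a continuous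
  character `χ : Γ_K^{ab} → ℚ/ℤ` vanishing on `(Γ_K^{ab})ᵐ` (so `m·χ = 0`) with `χ(θ a) ≠ 0`
  (Pontryagin: closed subgroups of a profinite abelian group are dually closed, the tree's
  `exists_character_trivialOn_apply_ne_zero`); equivalently `mem_range_pow_iff_forall_character`:
  `a ∈ C_Kᵐ ↔ χ(θ a) = 0` for every continuous `ℚ/ℤ`-character `χ` of `Γ_K^{ab}` with `χ((Γ^{ab})ᵐ) = 0`.

USE (Route A to Poitou–Tate over the FULL Galois group, cells door-c4/door-c5/door-c6 of
bsd-schneider-ideate; `Theorems/SchneiderFreeAdditiveX3PoitouTateAllPlacesReduction.lean`): this is the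
arithmetic input «`α¹(Γ_F, ℤ/m) : Ext¹_{Γ_F}(ℤ/m, C̄) = C_F/m → H¹(Γ_F, ℤ/m)^* = Hom_cont(Γ_F^{ab}, ℤ/m)^*` is
injective (and `C_F/m ≅ Γ_F^{ab}/m`)» of Tate's duality theorem for the class formation `(Γ_K, C̄)` (Milne,
*ADT* I Thm. 1.8 (b) hypothesis, Lemma 4.5 / Harari Prop. 15.42 in the `S = all places` case), obtained
WITHOUT the topological description of `D_K` as the connected component: Neukirch's algebraic description
`D_K = ⋂ₙ C_Kⁿ` gives `D_K ⊆ C_Kᵐ` for free.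

HONEST FRAMING: classical global class field theory (all inputs are tree theorems); nothing here bears on BSD.

## References
* J. Neukirch, *Class Field Theory — The Bonn Lectures* (2013), Part III Thm. (7.12) (`( , K)` surjective,
  kernel `D_K = ⋂ₙ C_Kⁿ`), Thm. (7.8) (existence theorem). [Neukirch2013]
* J. S. Milne, *Arithmetic Duality Theorems* (2006), I Lemma 4.5 and the proof of Thm. 4.6 (the map
  `α¹(G, ℤ/m)`: `C/m → (G^{ab}/m)`). [MilneADT2006]
* J.-P. Serre, *Local Fields* (1979), XIII §1 (characters of profinite abelian groups). [SerreLocalFields1979]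
-/

noncomputable section

open Field Function

universe u

namespace Literature.NumberTheory.GaloisRepresentations

open _root_.TopRep _root_.ContRepresentation _root_.ContinuousCohomology

namespace IsGlobalReciprocityMap

variable {K : Type u} [Field K] [NumberField K]
variable {θ : ideleGroup K ⧸ principalIdeles K →* absoluteGaloisGroupAbelianization K}

/-! ## §1. `θ` modulo `m`-th powers -/

/-- **`ker θ ≤ C_Kᵐ`**: a class in the kernel of the norm residue symbol is infinitely divisible
(Neukirch III (7.12)), in particular an `m`-th power for every `m ≥ 1`. [cite: Neukirch2013, Part III Thm. (7.12)] -/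
theorem exists_pow_eq_of_map_eq_one (hθ : IsGlobalReciprocityMap K θ)
    {a : ideleGroup K ⧸ principalIdeles K} (ha : θ a = 1) {m : ℕ} (hm : 0 < m) :
    ∃ b : ideleGroup K ⧸ principalIdeles K, b ^ m = a :=
  (hθ.map_eq_one_iff a).1 ha m hm

/-- **`θ a` is an `m`-th power in `Γ_K^{ab}` iff `a` is an `m`-th power in `C_K`** (`m ≥ 1`): if
`θ a = gᵐ`, write `g = θ b` (`θ` is onto); then `a b⁻ᵐ ∈ ker θ` is an `m`-th power.
[cite: Neukirch2013, Part III Thm. (7.12)] -/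
theorem map_mem_range_powMonoidHom_iff (hθ : IsGlobalReciprocityMap K θ) {m : ℕ} (hm : 0 < m)
    (a : ideleGroup K ⧸ principalIdeles K) :
    θ a ∈ (@powMonoidHom (absoluteGaloisGroupAbelianization K) _ m).range ↔
      a ∈ (@powMonoidHom (ideleGroup K ⧸ principalIdeles K) _ m).range := by
  constructor
  · rintro ⟨g, hg⟩
    obtain ⟨b, rfl⟩ := hθ.surjective g
    rw [powMonoidHom_apply, ← map_pow] at hg
    have h1 : θ (a * (b ^ m)⁻¹) = 1 := by rw [map_mul, map_inv, ← hg, mul_inv_cancel]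
    obtain ⟨c, hc⟩ := hθ.exists_pow_eq_of_map_eq_one h1 hm
    refine ⟨c * b, ?_⟩
    rw [powMonoidHom_apply]
    calc (c * b) ^ m = c ^ m * b ^ m := mul_pow c b m
      _ = a := by rw [hc, inv_mul_cancel_right]
  · rintro ⟨b, rfl⟩
    exact ⟨θ b, by rw [powMonoidHom_apply, powMonoidHom_apply, map_pow]⟩

/-- `θ⁻¹((Γ_K^{ab})ᵐ) = C_Kᵐ` (`m ≥ 1`). [cite: Neukirch2013, Part III Thm. (7.12)] -/
theorem comap_range_powMonoidHom (hθ : IsGlobalReciprocityMap K θ) {m : ℕ} (hm : 0 < m) :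
    ((@powMonoidHom (absoluteGaloisGroupAbelianization K) _ m).range).comap θ =
      (@powMonoidHom (ideleGroup K ⧸ principalIdeles K) _ m).range :=
  Subgroup.ext fun a => hθ.map_mem_range_powMonoidHom_iff hm a

/-- **`C_K / C_Kᵐ ≅ Γ_K^{ab} / (Γ_K^{ab})ᵐ`, coset form**: `θ a ≡ θ a'` modulo `m`-th powers iff
`a ≡ a'` modulo `m`-th powers (`m ≥ 1`); together with the surjectivity of `θ` this says that the
homomorphism `C_K / C_Kᵐ → Γ_K^{ab} / (Γ_K^{ab})ᵐ` induced by the norm residue symbol is a BIJECTION — the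
reciprocity isomorphism read modulo `m`, i.e. the bijectivity of Milne's `α¹(Γ_K, ℤ/m) : C_K/m → Γ_K^{ab}/m`
for the class formation `(Γ_K, C̄)` (`θ⁻¹((Γ^{ab})ᵐ) = C_Kᵐ · ker θ = C_Kᵐ`).
[cite: Neukirch2013, Part III Thm. (7.12)] [cite: MilneADT2006, Ch. I, Lemma 4.5] -/
theorem map_div_mem_range_powMonoidHom_iff (hθ : IsGlobalReciprocityMap K θ) {m : ℕ} (hm : 0 < m)
    (a a' : ideleGroup K ⧸ principalIdeles K) :
    θ a / θ a' ∈ (@powMonoidHom (absoluteGaloisGroupAbelianization K) _ m).range ↔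
      a / a' ∈ (@powMonoidHom (ideleGroup K ⧸ principalIdeles K) _ m).range := by
  rw [← map_div]
  exact hθ.map_mem_range_powMonoidHom_iff hm _

/-- Surjectivity modulo `m`-th powers (from the surjectivity of `θ`): every `g ∈ Γ_K^{ab}` is `θ a` up
to an `m`-th power (indeed on the nose). [cite: Neukirch2013, Part III Thm. (7.12)] -/
theorem exists_map_div_mem_range_powMonoidHom (hθ : IsGlobalReciprocityMap K θ) (m : ℕ)
    (g : absoluteGaloisGroupAbelianization K) :
    ∃ a : ideleGroup K ⧸ principalIdeles K,
      g / θ a ∈ (@powMonoidHom (absoluteGaloisGroupAbelianization K) _ m).range := by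
  obtain ⟨a, rfl⟩ := hθ.surjective g
  exact ⟨a, by rw [div_self']; exact one_mem _⟩

/-! ## §2. The `m`-th power classes are detected by characters of `Γ_K^{ab}` killed by `m` -/

omit [NumberField K] in
/-- **`(Γ_K^{ab})ᵐ` is closed in `Γ_K^{ab}`**: the image of the compact group `Γ_K^{ab}` under the
continuous map `g ↦ gᵐ`, in a Hausdorff group. [cite: SerreLocalFields1979, XIII §1] -/
theorem isClosed_range_powMonoidHom_abelianization (K : Type u) [Field K] (m : ℕ) :
    IsClosed (((@powMonoidHom (absoluteGaloisGroupAbelianization K) _ m).range :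
      Subgroup (absoluteGaloisGroupAbelianization K)) : Set (absoluteGaloisGroupAbelianization K)) := by
  haveI : T2Space (absoluteGaloisGroupAbelianization K) := absoluteGaloisGroupAbelianization.t2Space K
  haveI : CompactSpace (absoluteGaloisGroup K) := absoluteGaloisGroup_compactSpace K
  have h : (((@powMonoidHom (absoluteGaloisGroupAbelianization K) _ m).range :
      Subgroup (absoluteGaloisGroupAbelianization K)) : Set (absoluteGaloisGroupAbelianization K)) =
      (fun g : absoluteGaloisGroupAbelianization K => g ^ m) '' Set.univ := by
    rw [MonoidHom.coe_range, Set.image_univ]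
    rfl
  rw [h]
  exact (isCompact_univ.image (continuous_pow m)).isClosed

omit [NumberField K] in
/-- `Γ_K^{ab}` is totally disconnected (quotient of the profinite `Γ_K` by a closed normal subgroup).
[cite: SerreLocalFields1979, XIII §1] -/
theorem totallyDisconnectedSpace_abelianization (K : Type u) [Field K] :
    TotallyDisconnectedSpace (absoluteGaloisGroupAbelianization K) := by
  haveI : CompactSpace (absoluteGaloisGroup K) := absoluteGaloisGroup_compactSpace K
  exact Literature.GroupTheory.ProfiniteSubquotients.totallyDisconnectedSpace_quotient _
    (Subgroup.isClosed_topologicalClosure _)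

/-- **A class `a ∉ C_Kᵐ` is detected by a continuous character of `Γ_K^{ab}` killed by `m`**: there is a
continuous `χ : Γ_K^{ab} → ℚ/ℤ` vanishing on `(Γ_K^{ab})ᵐ` with `χ(θ a) ≠ 0` (`m ≥ 1`).  Indeed
`θ a ∉ (Γ^{ab})ᵐ` (`map_mem_range_powMonoidHom_iff`), a closed subgroup of the profinite abelian group
`Γ_K^{ab}`, and closed subgroups are dually closed (`exists_character_trivialOn_apply_ne_zero`).  This is the
injectivity of `α¹(Γ_K, ℤ/m) : C_K/m → Hom_cont(Γ_K^{ab}, ℤ/m)^*`.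
[cite: Neukirch2013, Part III Thm. (7.12)] [cite: SerreLocalFields1979, XIII §1] -/
theorem exists_character_apply_ne_zero_of_not_mem_range_pow (hθ : IsGlobalReciprocityMap K θ) {m : ℕ}
    (hm : 0 < m) {a : ideleGroup K ⧸ principalIdeles K}
    (ha : a ∉ (@powMonoidHom (ideleGroup K ⧸ principalIdeles K) _ m).range) :
    ∃ χ : contOneCocycles
        (ContinuousRep.trivial (absoluteGaloisGroupAbelianization K) ℤ QModZCoeff.{u}).toTopRep,
      (∀ g : absoluteGaloisGroupAbelianization K, χ.1 (g ^ m) = 0) ∧ χ.1 (θ a) ≠ 0 := by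
  haveI : TotallyDisconnectedSpace (absoluteGaloisGroupAbelianization K) :=
    totallyDisconnectedSpace_abelianization K
  haveI : CompactSpace (absoluteGaloisGroup K) := absoluteGaloisGroup_compactSpace K
  have ha' : θ a ∉ (@powMonoidHom (absoluteGaloisGroupAbelianization K) _ m).range :=
    fun h => ha ((hθ.map_mem_range_powMonoidHom_iff hm a).1 h)
  obtain ⟨χ, hχ, hχa⟩ := exists_character_trivialOn_apply_ne_zero
    ((@powMonoidHom (absoluteGaloisGroupAbelianization K) _ m).range)
    (isClosed_range_powMonoidHom_abelianization K m) ha'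
  exact ⟨χ, fun g => hχ (g ^ m) ⟨g, rfl⟩, hχa⟩

/-- **`a ∈ C_Kᵐ ↔ χ(θ a) = 0` for every continuous `ℚ/ℤ`-character `χ` of `Γ_K^{ab}` killed on `(Γ_K^{ab})ᵐ`**
(`m ≥ 1`): the `m`-th power classes of the idèle class group are exactly the common kernel of the
characters of `Gal(K^{ab}/K)` of exponent `m` pulled back along the norm residue symbol (existence theorem
+ `D_K ⊆ C_Kᵐ`, in Pontryagin-dual form). [cite: Neukirch2013, Part III Thm. (7.12) and (7.8)]
[cite: SerreLocalFields1979, XIII §1] -/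
theorem mem_range_pow_iff_forall_character (hθ : IsGlobalReciprocityMap K θ) {m : ℕ} (hm : 0 < m)
    (a : ideleGroup K ⧸ principalIdeles K) :
    a ∈ (@powMonoidHom (ideleGroup K ⧸ principalIdeles K) _ m).range ↔
      ∀ χ : contOneCocycles
          (ContinuousRep.trivial (absoluteGaloisGroupAbelianization K) ℤ QModZCoeff.{u}).toTopRep,
        (∀ g : absoluteGaloisGroupAbelianization K, χ.1 (g ^ m) = 0) → χ.1 (θ a) = 0 := by
  constructor
  · rintro ⟨b, rfl⟩ χ hχ
    rw [powMonoidHom_apply, map_pow]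
    exact hχ (θ b)
  · intro h
    by_contra ha
    obtain ⟨χ, hχ, hχa⟩ := hθ.exists_character_apply_ne_zero_of_not_mem_range_pow hm ha
    exact hχa (h χ hχ)

end IsGlobalReciprocityMap

/-! ## §3. For `K : Type`: unconditionally, through `exists_isGlobalReciprocityMap_holds` -/

/-- **For every number field `K` (universe `Type`) there is a reciprocity map `θ`
(`IsGlobalReciprocityMap K θ`, the tree's theorem `exists_isGlobalReciprocityMap_holds`) such that for every
`m ≥ 1` the `m`-th power classes of `C_K` are exactly the classes killed by every continuous
`ℚ/ℤ`-character of `Γ_K^{ab}` vanishing on `(Γ_K^{ab})ᵐ`** — the arithmetic input `α¹(Γ_K, ℤ/m)` injective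
of Tate's duality theorem for `(Γ_K, C̄)`, unconditionally. [cite: Neukirch2013, Part III Thm. (7.12)]
[cite: MilneADT2006, Ch. I, Lemma 4.5] -/
theorem exists_isGlobalReciprocityMap_mem_range_pow_iff (K : Type) [Field K] [NumberField K] :
    ∃ θ : ideleGroup K ⧸ principalIdeles K →* absoluteGaloisGroupAbelianization K,
      IsGlobalReciprocityMap K θ ∧ ∀ (m : ℕ), 0 < m → ∀ a : ideleGroup K ⧸ principalIdeles K,
        (a ∈ (@powMonoidHom (ideleGroup K ⧸ principalIdeles K) _ m).range ↔
          ∀ χ : contOneCocycles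
              (ContinuousRep.trivial (absoluteGaloisGroupAbelianization K) ℤ QModZCoeff.{0}).toTopRep,
            (∀ g : absoluteGaloisGroupAbelianization K, χ.1 (g ^ m) = 0) → χ.1 (θ a) = 0) := by
  obtain ⟨θ, hθ⟩ := exists_isGlobalReciprocityMap_holds K
  exact ⟨θ, hθ, fun m hm a => hθ.mem_range_pow_iff_forall_character hm a⟩

end Literature.NumberTheory.GaloisRepresentations

end
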